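import Summits.BirchSwinnertonDyer.BirchSwinnertonDyer.Theorems.PublishedInputsGreenbergLayerFormalPrimary
import Summits.BirchSwinnertonDyer.BirchSwinnertonDyer.Theorems.PublishedInputsGreenbergLayerKernelCoinvariants
import Summits.BirchSwinnertonDyer.BirchSwinnertonDyer.Theorems.PublishedInputsGreenbergLayerCoinv
import Summits.BirchSwinnertonDyer.BirchSwinnertonDyer.Theorems.PublishedInputsGreenbergLayerHTwoVanishing
import Summits.BirchSwinnertonDyer.BirchSwinnertonDyer.Theorems.PublishedInputsGreenbergLemma34LocalCount
import Summits.BirchSwinnertonDyer.BirchSwinnertonDyer.Theorems.ByReductionTypeAtTwoMultTowerNS2LocalLayerIndex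
import HarnessLib

set_option linter.dupNamespace false -- `…BirchSwinnertonDyer.BirchSwinnertonDyer…` is the cell's nested layout (D-0017)
set_option autoImplicit false

/-!
# Greenberg LNM 1716 Lemma 3.4 at the LAYER `n` over `ℚ`, assembled: `#𝒦_{v,n}[p^∞] = N²` with
# `N = #{τ-fixed reductions}[p^∞]` (`= |Ẽ(𝔽_p)_p|`), at a good ORDINARY `v ∣ p`, every layer `n`, anomalous or not

Seat `bsd-inputs-k4-p1` (gen 6; LADDER-BSD D-0154 KEY (147)(f) «prove the printed input», row 1 K4 INPUTS; Greenberg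
1999), `--supports stmt-BirchSwinnertonDyer-20309`. THEOREMS ONLY (no definition, no named fact, no `sorry`).

R. Greenberg, *Iwasawa theory for elliptic curves*, LNM 1716 (1999), §3 Lemma 3.4 (p. 89): "Assume that `E` has good,
ordinary reduction at `v`. Then `|ker(r_{v_n})| = |Ẽ(f_{v_n})_p|²`." Over `ℚ` the residue field `f_{v_n}` is `𝔽_p` at every
layer (total ramification of `p` in `ℚ_∞`). Gen 5 assembled the layer `0` (`natCard_localTowerKerPrimary_zero_eq_mul_self`);
this file runs the same assembly at the layer `n` with the bricks of this gen: the kernel count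
`#𝒦_{v,n}[p^∞] = #(M/(g^{pⁿ}−1)M)[p^∞]` (`natCard_localTowerKerPrimary_eq_of_isTopGenerator`, `M = E(ℚ̄_v)^{H_∞}`, `g` a
topological generator of the localised `ℤ_p`-extension `κ ∘ res_v`, onto at `v ∣ p`), the dévissage
(`natCard_primaryComponent_quotient_eq_mul`) with the coinvariant vanishing at the layer `n`
(`coinvInput_layer_of_formalH2_of_coatesGreenberg`, from `H²(H_n, Ê[p^∞]) = 0` —
`subsingleton_continuousCohomology_two_restrict_formalTorsion`) and Hensel lifts, `#(M₁/(g^{pⁿ}−1)M₁)[p^∞] = N`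
(`natCard_primaryComponent_coinv_formal_eq_layer`), `#red(M)[p^∞] = N` (Hensel).

* `natCard_localTowerKerPrimary_eq_mul_self` — for `W/ℚ` globally minimal and elliptic with `GoodOrd W p`, `κ` cyclotomic,
  `v ∣ p`, the spectral valuation `w` and a prime `𝔐` of `\bar 𝓞_v` above `v`, EVERY layer `n`: there is an arithmetic
  Frobenius `τ` fixing `μ_{p^∞}` with **`#𝒦_{v,n}[p^∞] = N · N`**, `N = #{y ∈ Ẽ_{W₀}(k_w) : y p-power torsion,
  y = red Q = red(τQ)}` (identified with `p^{ord_p #Ẽ(𝔽_p)}` by gen 5's `natCard_fixedReduction_primary_eq_pow`).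

HONEST FRAMING: a composition of tree theorems; closes nothing; no summit statement is proved; BSD is not proved by
any of this.

References: [GreenbergLNM1716] §2 Props. 2.1–2.5 (pp. 70–80), §3 Lemma 3.4 (pp. 89–90), §4 p. 108;
[CoatesGreenberg1996] Cor. 3.2; [MilneADT2006] I Thm. 2.8, Cor. 2.3; [SilvermanAEC2009] III.8.1, VII.2.1.
-/

noncomputable section

open scoped Classical NNReal

namespace Summit.BirchSwinnertonDyer.BirchSwinnertonDyer.Theorems.InputsGreenbergLemma34Layer

open CategoryTheory NumberField IsDedekindDomain Field
  Literature.NumberTheory.GaloisRepresentations IsDedekindDomain.HeightOneSpectrum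
  Literature.NumberTheory.EllipticCurves.FormalGroupChart Literature.NumberTheory.EllipticCurves.ResKernel
  Literature.NumberTheory.EllipticCurves.Rank1Residual Literature.NumberTheory.EllipticCurves.CoatesGreenberg1996
  Literature.NumberTheory.EllipticCurves.Greenberg1999 WeierstrassCurve
  Summit.BirchSwinnertonDyer.BirchSwinnertonDyer.Theorems.GoodOrdTower
  Summit.BirchSwinnertonDyer.BirchSwinnertonDyer.Theorems.InputsGreenbergLocalAtP
  Summit.BirchSwinnertonDyer.BirchSwinnertonDyer.Theorems.InputsGreenbergLemma34
open Literature.NumberTheory.EllipticCurves hiding subgroupIncl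

set_option maxHeartbeats 3200000 in
/-- **Greenberg's Lemma 3.4 at the LAYER `n` over `ℚ`, exact count modulo the identification of the Frobenius-fixed
reductions with `Ẽ(𝔽_p)`**: for `W/ℚ` globally minimal and elliptic with good ordinary reduction at `p`, `κ` the cyclotomic
`ℤ_p`-extension, `v ∣ p`, a layer `n`, the spectral valuation `w` on `ℚ̄_v` and a prime `𝔐` of `\bar 𝓞_v` over `v`, there
is an arithmetic Frobenius `τ` at `𝔐` fixing every `p`-power root of unity such that `#𝒦_{v,n}[p^∞] = N · N`, `N` the
number of `p`-power-torsion points `y` of the reduction `W₀ mod 𝔪_w` (`W₀ = W_ℤ ⊗ 𝒪_w`) with `y = red Q = red (τQ)` for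
some `Q ∈ E(ℚ̄_v)` — the same `N` as at the layer `0` (`f_{v_n} = 𝔽_p`). Layer-`n` form of gen 5's
`natCard_localTowerKerPrimary_zero_eq_mul_self`: the kernel count (brick 4), the dévissage with the layer-`n` coinvariant
vanishing (bricks 9–11) and Hensel lifts, the formal count (bricks 5–8), for the generator `g^{pⁿ}` of the localised
`ℤ_p`-extension `κ ∘ res_v`. [cite: GreenbergLNM1716, §3 Lemma 3.4 (p. 89); §2 Prop. 2.5 (p. 80); §4 p. 108]
[cite: CoatesGreenberg1996, Cor. 3.2] [cite: MilneADT2006, I Thm. 2.8 and Cor. 2.3] -/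
theorem natCard_localTowerKerPrimary_eq_mul_self {p : ℕ} [hp : Fact p.Prime] (W : WeierstrassCurve ℚ)
    [W.IsGloballyMinimal] [W.IsElliptic] (hgo : GoodOrd W p) (κ : ZpExtension ℚ p) (hκ : κ.IsCyclotomic)
    (v : HeightOneSpectrum (𝓞 ℚ)) (hpv : ((p : ℕ) : 𝓞 ℚ) ∈ v.asIdeal) (n : ℕ)
    {w : Valuation (AlgebraicClosure (v.adicCompletion ℚ)) ℝ≥0}
    (hw : ∀ x, (w x : ℝ) = spectralNorm (v.adicCompletion ℚ) (AlgebraicClosure (v.adicCompletion ℚ)) x)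
    {𝔐 : Ideal v.localAbsIntegers} (h𝔐 : 𝔐 ∈ v.localPrimesAbove) :
    ∃ τ : absoluteGaloisGroup (v.adicCompletion ℚ), IsArithFrobAt (v.adicCompletionIntegers ℚ) τ 𝔐 ∧
      (∀ (r : ℕ) (ξ : AlgebraicClosure (v.adicCompletion ℚ)), ξ ^ p ^ r = 1 → τ • ξ = ξ) ∧
      Nat.card (W.localTowerKerPrimary κ (v.adicCompletion ℚ) n) =
        Nat.card {y : (((integralModelInt W).map (algebraMap ℤ ↥w.valuationSubring)).map
            (IsLocalRing.residue ↥w.valuationSubring)).toAffine.Point //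
          (∃ n : ℕ, p ^ n • y = 0) ∧ ∃ Q : localPoints W (v.adicCompletion ℚ),
            ((integralModelInt W).map (algebraMap ℤ ↥w.valuationSubring)).reducePoint
                (Affine.Point.congrEquiv (localIntModel_baseChange W w.valuationSubring).symm Q) = y ∧
              ((integralModelInt W).map (algebraMap ℤ ↥w.valuationSubring)).reducePoint
                (Affine.Point.congrEquiv (localIntModel_baseChange W w.valuationSubring).symm (τ • Q)) = y} *
        Nat.card {y : (((integralModelInt W).map (algebraMap ℤ ↥w.valuationSubring)).map
            (IsLocalRing.residue ↥w.valuationSubring)).toAffine.Point //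
          (∃ n : ℕ, p ^ n • y = 0) ∧ ∃ Q : localPoints W (v.adicCompletion ℚ),
            ((integralModelInt W).map (algebraMap ℤ ↥w.valuationSubring)).reducePoint
                (Affine.Point.congrEquiv (localIntModel_baseChange W w.valuationSubring).symm Q) = y ∧
              ((integralModelInt W).map (algebraMap ℤ ↥w.valuationSubring)).reducePoint
                (Affine.Point.congrEquiv (localIntModel_baseChange W w.valuationSubring).symm (τ • Q)) = y} := by
  -- adapted from Summits/.../Theorems/PublishedInputsGreenbergLemma34LocalCount.lean (gen 5, layer 0)
  -- notation
  let K := v.adicCompletion ℚ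
  let Pt : Type := localPoints W K
  let Γ := absoluteGaloisGroup K
  let Hi : Subgroup Γ := localSubgroup κ.kerSubgroup K
  let Hn : Subgroup Γ := localSubgroup (κ.layerSubgroup n) K
  haveI : CompactSpace Γ := absoluteGaloisGroup_compactSpace K
  haveI hHiN : Hi.Normal := by
    change (localSubgroup κ.kerSubgroup K).Normal
    rw [localSubgroup_eq_comap]; exact Subgroup.Normal.comap inferInstance _
  haveI hHnN : Hn.Normal := by
    change (localSubgroup (κ.layerSubgroup n) K).Normal
    rw [localSubgroup_eq_comap]; exact Subgroup.Normal.comap inferInstance _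
  have hHile : Hi ≤ Hn := localSubgroup_ker_le_layer κ K n
  have hopen : IsOpen (Hn : Set Γ) := MultTowerNS2.isOpen_localSubgroup _ (κ.isOpen_layerSubgroup n) K
  -- the localised `ℤ_p`-extension `κ ∘ res_v` (onto at `v ∣ p`) and a topological generator `g`
  have hns : Function.Surjective (κ.toContinuousMonoidHom.comp (resGal (K := ℚ) K)) := fun t ↦
    MultTowerNS2.surjective_kappa_comp_resGal hκ v hpv t
  let κE : ZpExtension K p := κ.localize (closureEmb (K := ℚ) K) hns
  obtain ⟨g, hg⟩ := κE.surjective (Multiplicative.ofAdd 1)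
  have hγ : κE.IsTopGenerator g := hg
  have hkerE : κE.kerSubgroup = Hi := rfl
  have hlayE : κE.layerSubgroup n = Hn := rfl
  have galois_smul_nsmul : ∀ (σ : Γ) (n : ℕ) (P : Pt), σ • (n • P) = n • (σ • P) :=
    fun σ n P ↦ map_nsmul (DistribSMul.toAddMonoidHom Pt σ) n P
  -- the local data at `v ∣ p`
  have hord : W.HasGoodReductionAtPrime p ∧ ¬ ((p : ℕ) : ℤ) ∣ W.frobeniusTrace p := hgo
  have hΔ : ¬ ((p : ℕ) : ℤ) ∣ minimalDiscriminantInt W :=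
    W.not_dvd_minimalDiscriminantInt_of_hasGoodReductionAtPrime' p hord.1
  have hap := hord.2
  have hvO : w.Integers w.valuationSubring := Valuation.valuationSubring.integers w
  have hΔu := W.isUnit_Δ_localIntModel hpv hw hΔ
  let red₀ : Pt →+ (((integralModelInt W).map (algebraMap ℤ ↥w.valuationSubring)).map
        (IsLocalRing.residue ↥w.valuationSubring)).toAffine.Point :=
    (goodReductionHom _ hvO hΔu).comp
      (Affine.Point.congrEquiv (localIntModel_baseChange W w.valuationSubring).symm).toAddMonoidHom
  have hred₀ : ∀ P : Pt, red₀ P =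
      ((integralModelInt W).map (algebraMap ℤ ↥w.valuationSubring)).reducePoint
        (Affine.Point.congrEquiv (localIntModel_baseChange W w.valuationSubring).symm P) :=
    fun P ↦ rfl
  haveI hV : (W.baseChange (AlgebraicClosure K)).IsIntegral w.integer :=
    ⟨⟨(integralModelInt W).map (algebraMap ℤ ↥w.integer), W.baseChange_eq_localIntModel_integer_baseChange⟩⟩
  have hker : ∀ Q : Pt, red₀ Q = 0 ↔ (Q : (W.baseChange (AlgebraicClosure K)).toAffine.Point) ∈
      kernel w (W.baseChange (AlgebraicClosure K)) := fun Q ↦ W.localRed_eq_zero_iff_mem_kernel hΔu red₀ hred₀ Q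
  have hpO : w ((p : ℕ) : AlgebraicClosure K) < 1 := by
    have h := spectralValuation_algebraMap_ringOfIntegers_lt_one (v := v) hw hpv
    rwa [map_natCast] at h
  haveI hchar : CharP (IsLocalRing.ResidueField ↥w.valuationSubring) p := by
    refine (CharP.charP_iff_prime_eq_zero hp.out).mpr ?_
    rw [← map_natCast (IsLocalRing.residue ↥w.valuationSubring), IsLocalRing.residue_eq_zero_iff,
      IsLocalRing.mem_maximalIdeal, mem_nonunits_iff, hvO.isUnit_iff_valuation_eq_one, map_natCast]
    exact ne_of_lt hpO
  -- the Frobenius inside `H_∞`, the ordinary filtration, the finite set `SF`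
  have hϖ : Irreducible ((p : ℕ) : v.adicCompletionIntegers ℚ) := irreducible_natCast_adicCompletionIntegers_rat hpv
  obtain ⟨τ, hτ, hτfix⟩ := exists_isArithFrobAt_forall_smul_eq hw h𝔐 hpv hϖ
  have hτHi : τ ∈ Hi :=
    (mem_localSubgroup_iff _ _ τ).mpr (resGal_mem_kerSubgroup_of_forall_smul_rootOfUnity_eq hκ hτfix)
  have hordA := W.exists_zsmul_eq_zero_localRed_ne_zero hw hΔu red₀ hred₀ hpv hΔ hap
  obtain ⟨hgenr, hsurj, hdiv₁⟩ := W.localRed_ordinary_filtration hΔu red₀ hred₀ hordA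
  obtain ⟨SF, hSF⟩ := W.exists_finset_localRed_smul_frobenius hw hΔu red₀ hred₀ h𝔐 hτ
  have hstab : ∀ (σ : Γ) (Q : Pt), red₀ Q = 0 → red₀ (σ • Q) = 0 :=
    fun σ Q hQ ↦ (W.localRed_smul_eq_zero_iff hw hΔu red₀ hred₀ σ Q).mpr hQ
  have hkst : ∀ (σ : Γ) (a : Pt), a ∈ red₀.ker → σ • a ∈ red₀.ker :=
    fun σ a ha ↦ (AddMonoidHom.mem_ker).mpr (hstab σ a ((AddMonoidHom.mem_ker).mp ha))
  have htor : ∀ P : Pt, ∃ n : ℕ, 0 < n ∧ red₀ (n • P) = 0 := fun P ↦ W.exists_nsmul_localRed_eq_zero hw red₀ P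
  have hHensel : ∀ Q : Pt, red₀ (τ • Q) = red₀ Q → ∃ P₀ : Pt, (∀ σ : Γ, σ • P₀ = P₀) ∧ red₀ P₀ = red₀ Q :=
    fun Q hQ ↦ exists_fixed_localRed_eq W hw hΔu red₀ hred₀ hpv hΔ h𝔐 hτ Q hQ
  -- the subgroup `C∞ = E₁ ∩ E(K̄_v)[p^∞]` and the Galois representation on it (for `H² = 0`)
  let C : AddSubgroup Pt := red₀.ker ⊓ AddCommGroup.primaryComponent Pt p
  have hC : ∀ a : Pt, a ∈ C ↔ red₀ a = 0 ∧ ∃ e : ℕ, p ^ e • a = 0 := fun a ↦ by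
    change a ∈ red₀.ker ⊓ AddCommGroup.primaryComponent Pt p ↔ _
    rw [AddSubgroup.mem_inf, AddMonoidHom.mem_ker, AddCommGroup.mem_primaryComponent]
  have hCstab : ∀ (σ : Γ) (a : Pt), a ∈ C → σ • a ∈ C := fun σ a ha ↦ by
    obtain ⟨ha0, e, he⟩ := (hC a).mp ha
    exact (hC _).mpr ⟨hstab σ a ha0, e, by rw [← galois_smul_nsmul, he, smul_zero]⟩
  letI iSMul : SMul Γ C := ⟨fun σ z ↦ ⟨σ • (z : Pt), hCstab σ z z.2⟩⟩
  have hsmul : ∀ (σ : Γ) (z : C), ((σ • z : C) : Pt) = σ • (z : Pt) := fun _ _ ↦ rfl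
  letI iMA : MulAction Γ C :=
    { one_smul := fun z ↦ Subtype.ext (by rw [hsmul, one_smul])
      mul_smul := fun σ σ' z ↦ Subtype.ext (by rw [hsmul, hsmul, hsmul, mul_smul]) }
  letI iDMA : DistribMulAction Γ C :=
    { smul_zero := fun σ ↦ Subtype.ext (by rw [hsmul, ZeroMemClass.coe_zero, smul_zero])
      smul_add := fun σ z z' ↦ Subtype.ext (by
        rw [hsmul, AddMemClass.coe_add, AddMemClass.coe_add, hsmul, hsmul, smul_add]) }
  let ρ : ContinuousRep Γ ℤ C :=
    ContinuousRep.ofStabilizerMemNhdsOne (Representation.ofDistribMulAction ℤ Γ C) fun z ↦ by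
      have hopen' : IsOpen ((fun σ : Γ ↦ σ • (z : Pt)) ⁻¹' {(z : Pt)}) :=
        (isOpen_discrete _).preimage (continuous_smul_localPoints W K (z : Pt))
      refine Filter.mem_of_superset (hopen'.mem_nhds (by simp)) fun σ hσ ↦ ?_
      exact Subtype.ext hσ
  have hρ : ∀ (σ : Γ) (z : C), ((ρ σ z : C) : Pt) = σ • (z : Pt) := fun _ _ ↦ rfl
  have hH2 : Subsingleton (continuousCohomology 2 (ρ.restrict (subgroupIncl (κE.layerSubgroup n))).toTopRep) :=
    subsingleton_continuousCohomology_two_restrict_formalTorsion v W red₀ hstab hdiv₁ hgenr hsurj hτfix SF hSF C hC ρ hρ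
      Hn hopen (hHile hτHi)
  -- the Coates–Greenberg vanishing for the good model `W_ℤ ⊗ 𝒪_w` (`C = 1`), in `red₀`-currency on `H_∞`
  let W₀ : WeierstrassCurve w.integer := (integralModelInt W).map (algebraMap ℤ ↥w.valuationSubring)
  have hΔ' : IsUnit W₀.Δ := hΔu
  have e₁ : W₀.baseChange (AlgebraicClosure K) = W.baseChange (AlgebraicClosure K) :=
    localIntModel_baseChange W w.valuationSubring
  have hW₀ : (1 : VariableChange (AlgebraicClosure K)) • (W.baseChange K).baseChange (AlgebraicClosure K) =
      W₀.baseChange (AlgebraicClosure K) := by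
    rw [one_smul, baseChange_baseChange_adicCompletion, e₁]
  have hred : ∀ P : Pt, red₀ P = goodReductionHom W₀ (Valuation.integer.integers w) hΔ'
      (Affine.Point.congrEquiv hW₀ (VariableChange.pointEquiv _ 1
        (Affine.Point.congrEquiv (baseChange_baseChange_adicCompletion W v).symm P))) := by
    intro P
    rw [hred₀, goodReductionHom_apply]
    congr 1
    change (W.baseChange (AlgebraicClosure K)).toAffine.Point at P
    rcases P with _ | ⟨x, y, hP⟩
    · simp only [← Affine.Point.zero_def, map_zero]
      rfl
    · simp only [Affine.Point.congrEquiv_some, VariableChange.pointEquiv_some]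
      exact point_some_congr (toX_one x).symm (toY_one x y).symm
  have hmem1 : ∀ P : Pt, red₀ P = 0 → Affine.Point.congrEquiv hW₀ (VariableChange.pointEquiv _ 1
      (Affine.Point.congrEquiv (baseChange_baseChange_adicCompletion W v).symm P)) ∈
        kernelOfReduction W₀ (Valuation.integer.integers w) := fun P hP ↦ by
    rw [mem_kernelOfReduction_iff, ← goodReductionHom_eq_zero_iff (Valuation.integer.integers w) hΔ', ← hred]
    exact hP
  have hmem2 : ∀ P : Pt, Affine.Point.congrEquiv hW₀ (VariableChange.pointEquiv _ 1
      (Affine.Point.congrEquiv (baseChange_baseChange_adicCompletion W v).symm P)) ∈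
        kernelOfReduction W₀ (Valuation.integer.integers w) → red₀ P = 0 := fun P hP ↦ by
    rw [mem_kernelOfReduction_iff, ← goodReductionHom_eq_zero_iff (Valuation.integer.integers w) hΔ', ← hred] at hP
    exact hP
  have hGc : IsClosed ((Hi : Set Γ)) := κ.isClosed_kerSubgroup.preimage (map_continuous (resGal (K := ℚ) K))
  have hGC : ∀ σ ∈ Hi, (1 : VariableChange (AlgebraicClosure K)).map
      ((absoluteGaloisGroup.toAlgEquiv K σ : AlgebraicClosure K ≃ₐ[K] AlgebraicClosure K) :
        AlgebraicClosure K →+* AlgebraicClosure K) = 1 :=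
    fun σ _ ↦ (VariableChange.mapHom _).map_one
  have hCG_Hi : ∀ ψ : contOneCocycles (discreteTopRep Hi Pt), (∀ g, red₀ (ψ.1 g) = 0) →
      ∃ e : Pt, red₀ e = 0 ∧ ∀ g : Hi, ψ.1 g = (g : Γ) • e - e := by
    intro ψ hψ
    obtain ⟨e, he, hφe⟩ := H1_goodModelKernel_trivial_holds ℚ W p κ hκ v hpv w hw 1 W₀ hW₀ hΔ' Hi hGc le_rfl hGC ψ
      (fun g ↦ hmem1 _ (hψ g))
    exact ⟨e, hmem2 e he, fun g ↦ hφe g⟩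
  have hkerι : ∀ σ : Γ, σ ∈ κE.kerSubgroup ↔ σ ∈ Hi := fun σ ↦ by rw [hkerE]
  have hCG : ∀ ψ : contOneCocycles (discreteTopRep κE.kerSubgroup Pt), (∀ σ, red₀ (ψ.1 σ) = 0) →
      ∃ e : Pt, red₀ e = 0 ∧ ∀ σ : κE.kerSubgroup, ψ.1 σ = (σ : Γ) • e - e := by
    intro ψ hψ
    have hle : Hi ≤ κE.kerSubgroup := hkerE.ge
    let ψ' : contOneCocycles (discreteTopRep Hi Pt) := contOneCocycles.pullback (subgroupInclusion hle)
      (resHomOfEquivariant (subgroupInclusion hle) (AddMonoidHom.id Pt) (fun _ _ ↦ rfl)) ψ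
    have hψ' : ∀ g' : Hi, ψ'.1 g' = ψ.1 (subgroupInclusion hle g') := fun _ ↦ rfl
    obtain ⟨e, he0, he⟩ := hCG_Hi ψ' (fun g' ↦ by rw [hψ']; exact hψ _)
    refine ⟨e, he0, fun σ ↦ ?_⟩
    have h := he ⟨(σ : Γ), (hkerι σ).mp σ.2⟩
    rw [hψ'] at h
    exact h
  -- `M = E(K̄_v)^{H_∞}`, `D = g − 1`, `r = red₀|_M`, `M₁ = E₁ ∩ M`
  let Mt : Type := FixedPoints.addSubgroup Hi Pt
  let D : Mt →+ Mt := subOne Hi Pt (g ^ p ^ n)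
  let r : Mt →+ _ := red₀.comp (FixedPoints.addSubgroup Hi Pt).subtype
  have hr : ∀ x : Mt, r x = red₀ (x : Pt) := fun _ ↦ rfl
  have hMfix : ∀ (x : Mt) (σ : Γ), σ ∈ Hi → σ • (x : Pt) = x := fun x σ hσ ↦
    (FixedPoints.mem_addSubgroup _ _ _).mp x.2 ⟨σ, hσ⟩
  -- Hensel on `M`: reductions of points of `M` are `τ`-fixed, hence reductions of `Γ`-fixed points
  have hlift' : ∀ x : Mt, ∃ P₀ : Pt, (∀ σ : Γ, σ • P₀ = P₀) ∧ red₀ P₀ = red₀ (x : Pt) := fun x ↦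
    hHensel (x : Pt) (by rw [hMfix x τ hτHi])
  have hgred : ∀ x : Mt, red₀ ((g ^ p ^ n) • (x : Pt)) = red₀ (x : Pt) := by
    intro x
    obtain ⟨P₀, hP₀fix, hP₀⟩ := hlift' x
    have h0 : red₀ ((x : Pt) - P₀) = 0 := by rw [map_sub, hP₀, sub_self]
    have h1 := hstab (g ^ p ^ n) _ h0
    rw [smul_sub, hP₀fix (g ^ p ^ n), map_sub, hP₀, sub_eq_zero] at h1
    exact h1
  have hrD : ∀ x : Mt, r (D x) = 0 := fun x ↦ by
    rw [hr]; change red₀ ((g ^ p ^ n) • (x : Pt) - x) = 0; rw [map_sub, hgred, sub_self]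
  have hlift : ∀ x : Mt, ∃ x₀ : Mt, D x₀ = 0 ∧ r x₀ = r x := by
    intro x
    obtain ⟨P₀, hP₀fix, hP₀⟩ := hlift' x
    refine ⟨⟨P₀, (FixedPoints.mem_addSubgroup _ _ _).mpr fun σ ↦ hP₀fix σ⟩, Subtype.ext ?_, ?_⟩
    · rw [coe_subOne_apply, hP₀fix, sub_self]; rfl
    · rw [hr, hr]; exact hP₀
  -- `range r` is finite (inside `SF`)
  haveI hfinr : Finite r.range := by
    refine Finite.of_injective (fun y : r.range ↦ (⟨y.1, ?_⟩ : ↥SF)) fun a b h ↦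
      Subtype.ext (by simpa only [Subtype.mk.injEq] using h)
    obtain ⟨x, hx⟩ := y.2
    rw [← hx, hr]
    exact hSF _ (by rw [hMfix x τ hτHi])
  -- the coinvariant vanishing (H²) on `M` (gen 4), as elements of `M`
  have hcoinv : ∀ (x : Mt) (k : ℕ), ∃ (i : ℕ) (m R t : Mt), (∃ e : ℕ, p ^ e • t = 0) ∧
      p ^ i • x = D m + p ^ (k + i) • R + t := by
    intro x k
    obtain ⟨i, m, R, t, hm, hR, ⟨e, hte⟩, heq⟩ := coinvInput_layer_of_formalH2_of_coatesGreenberg v W κE hγ n red₀ hstab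
      hdiv₁ htor C hC ρ hρ hH2 hCG (x : Pt) (fun σ hσ ↦ hMfix x σ ((hkerι σ).mp hσ)) k
    let m' : Mt := ⟨m, (FixedPoints.mem_addSubgroup _ _ _).mpr fun σ ↦ hm σ ((hkerι σ).mpr σ.2)⟩
    let R' : Mt := ⟨R, (FixedPoints.mem_addSubgroup _ _ _).mpr fun σ ↦ hR σ ((hkerι σ).mpr σ.2)⟩
    let t' : Mt := p ^ i • x - D m' - p ^ (k + i) • R'
    have ht' : (t' : Pt) = t := by
      change ((p ^ i • x - D m' - p ^ (k + i) • R' : Mt) : Pt) = t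
      rw [AddSubgroupClass.coe_sub, AddSubgroupClass.coe_sub, AddSubmonoidClass.coe_nsmul, AddSubmonoidClass.coe_nsmul,
        coe_subOne_apply, heq]
      change ((g ^ p ^ n) • m - m) + p ^ (k + i) • R + t - ((g ^ p ^ n) • m - m) - p ^ (k + i) • R = t
      abel
    refine ⟨i, m', R', t', ⟨e, Subtype.ext ?_⟩, ?_⟩
    · rw [AddSubmonoidClass.coe_nsmul, ht', hte, ZeroMemClass.coe_zero]
    · change p ^ i • x = D m' + p ^ (k + i) • R' + (p ^ i • x - D m' - p ^ (k + i) • R')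
      abel
  -- `M₁ = E₁ ∩ M` with `D₁ = g − 1`, as in the bsd-2adic bricks
  let M₁s : AddSubgroup Pt := red₀.ker ⊓ FixedPoints.addSubgroup Hi Pt
  have hM₁s : ∀ a, a ∈ M₁s ↔ a ∈ red₀.ker ∧ ∀ h ∈ Hi, h • a = a := fun a ↦ by
    change a ∈ red₀.ker ⊓ FixedPoints.addSubgroup Hi Pt ↔ _
    rw [AddSubgroup.mem_inf, FixedPoints.mem_addSubgroup]
    exact ⟨fun ⟨h1, h2⟩ ↦ ⟨h1, fun σ hσ ↦ h2 ⟨σ, hσ⟩⟩, fun ⟨h1, h2⟩ ↦ ⟨h1, fun σ ↦ h2 σ σ.2⟩⟩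
  let D₁ : M₁s →+ M₁s :=
    { toFun := fun a ↦ ⟨(g ^ p ^ n) • (a : Pt) - a, ⟨red₀.ker.sub_mem (hkst (g ^ p ^ n) a a.2.1) a.2.1,
        (subOne Hi Pt (g ^ p ^ n) ⟨(a : Pt), a.2.2⟩).2⟩⟩
      map_zero' := Subtype.ext (by simp)
      map_add' := fun a b ↦ Subtype.ext (by
        simp only [AddSubgroup.coe_add, smul_add]
        abel) }
  have hD₁ : ∀ a : M₁s, ((D₁ a : M₁s) : Pt) = (g ^ p ^ n) • (a : Pt) - a := fun _ ↦ rfl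
  let j : M₁s →+ Mt := AddSubgroup.inclusion (inf_le_right : M₁s ≤ FixedPoints.addSubgroup Hi Pt)
  have hjinj : Function.Injective j := AddSubgroup.inclusion_injective _
  have hjr : ∀ x, r (j x) = 0 := fun x ↦ (AddMonoidHom.mem_ker).mp x.2.1
  have hrj : ∀ y : Mt, r y = 0 → ∃ x, j x = y := fun y hy ↦ ⟨⟨y, ⟨(AddMonoidHom.mem_ker).mpr hy, y.2⟩⟩, rfl⟩
  have hD₁j : ∀ x : M₁s, j (D₁ x) = D (j x) := fun x ↦ Subtype.ext rfl
  -- integrality over the layer-`0` field (for Lutz), and the formal `p`-primary count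
  haveI := MultTowerNS2.finiteDimensional_fixedField_localSubgroup_layerSubgroup (κ := κ) v n
  haveI hVL : (W.baseChange (IntermediateField.fixedField (localSubgroup (κ.layerSubgroup n) K) :
      IntermediateField K (AlgebraicClosure K))).IsIntegral
      (w.comap (algebraMap (IntermediateField.fixedField (localSubgroup (κ.layerSubgroup n) K) :
        IntermediateField K (AlgebraicClosure K)) (AlgebraicClosure K))).integer := by
    refine ⟨⟨(integralModelInt W).map (algebraMap ℤ _), ?_⟩⟩
    conv_lhs => rw [← map_integralModelInt W]
    rw [baseChange, baseChange, WeierstrassCurve.map_map, WeierstrassCurve.map_map]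
    congr 1
    exact RingHom.ext_int _ _
  obtain ⟨hfin1, hN1⟩ := natCard_primaryComponent_coinv_formal_eq_layer hκ v hpv W n hw red₀ hker hstab hdiv₁ hgenr hsurj
    hτHi hτfix hHensel hns hγ M₁s hM₁s D₁ hD₁ hCG_Hi SF hSF
  haveI := hfin1
  -- the dévissage and the kernel count
  obtain ⟨-, hdev⟩ := natCard_primaryComponent_quotient_eq_mul p D r hrD hlift hcoinv j hjinj hjr hrj D₁ hD₁j
  have hK : Nat.card (W.localTowerKerPrimary κ K n) =
      Nat.card (AddCommGroup.primaryComponent (Mt ⧸ D.range) p) :=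
    @natCard_localTowerKerPrimary_eq_of_isTopGenerator K _
      (charZero_of_injective_algebraMap (algebraMap ℚ K).injective) p _ ℚ _ W κ _ hns g hγ n
  -- `range r = τ-fixed reductions`
  have hN2 : Nat.card (AddCommGroup.primaryComponent r.range p) =
      Nat.card {y : (((integralModelInt W).map (algebraMap ℤ ↥w.valuationSubring)).map
            (IsLocalRing.residue ↥w.valuationSubring)).toAffine.Point //
          (∃ n : ℕ, p ^ n • y = 0) ∧ ∃ Q : Pt, red₀ Q = y ∧ red₀ (τ • Q) = y} := by
    refine Nat.card_congr ?_
    exact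
      { toFun := fun a ↦ ⟨((a.1 : r.range) : _), by
          obtain ⟨n, hn⟩ := (AddCommGroup.mem_primaryComponent).mp a.2
          refine ⟨⟨n, ?_⟩, ?_⟩
          · have h := congrArg Subtype.val hn
            simpa only [AddSubmonoidClass.coe_nsmul, ZeroMemClass.coe_zero] using h
          · obtain ⟨x, hx⟩ := (a.1 : r.range).2
            exact ⟨(x : Pt), by rw [← hr, hx], by rw [hMfix x τ hτHi, ← hr, hx]⟩⟩
        invFun := fun y ↦ ⟨⟨y.1, by
            obtain ⟨-, Q, hQ, hτQ⟩ := y.2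
            obtain ⟨P₀, hP₀fix, hP₀⟩ := hHensel Q (by rw [hτQ, hQ])
            exact ⟨⟨P₀, (FixedPoints.mem_addSubgroup _ _ _).mpr fun σ ↦ hP₀fix σ⟩, by rw [hr]; exact hP₀.trans hQ⟩⟩,
          (AddCommGroup.mem_primaryComponent).mpr (by
            obtain ⟨⟨n, hn⟩, -⟩ := y.2
            exact ⟨n, Subtype.ext (by rw [AddSubmonoidClass.coe_nsmul, ZeroMemClass.coe_zero]; exact hn)⟩)⟩
        left_inv := fun a ↦ Subtype.ext (Subtype.ext rfl)
        right_inv := fun y ↦ Subtype.ext rfl }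
  refine ⟨τ, hτ, hτfix, ?_⟩
  rw [hK, hdev, hN1, hN2]
  rfl

end Summit.BirchSwinnertonDyer.BirchSwinnertonDyer.Theorems.InputsGreenbergLemma34Layer

end
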